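import Summits.ResolutionOfSingularities.ResolutionOfSingularities.Theorems.HomologicalConductorNoZenoRPowerMulMapSections
import Summits.ResolutionOfSingularities.ResolutionOfSingularities.Theorems.HomologicalConductorNoZenoRLipman81Of72
import HarnessLib

/-!
# Crux `NoZenoR` (stmt-ResolutionOfSingularities-19943) — road (R1′), step (b) and the DISCHARGE of Prop. (8.1):
# the kernel of `Ψₙ : (𝔪ⁿ𝒪_X)^{⊕s} ↠ 𝔪ⁿ⁺¹𝒪_X` is generated by the global Koszul sections, so `Ȟ¹(ker Ψₙ) = 0`,
# all powers `𝔪ⁿ` are contracted and complete, and `Bl_𝔪(Spec S)` is normal: `Lipman1969_8_1.{0}` and `Lipman1969_4_1.{0}` HOLD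

Route `ResolutionOfSingularities/HomologicalConductor` (cell decomp-res, hand leafhand-res-homologicalconduct-22 g0).
OURS: AI-written, weaker than expert review; nothing here is a statement of the manuscript under review (Hironaka 2017).
SUPPORT level, counted 0.  Def-free, FACT-FREE.

For a desingularization `π : X → Spec S` of a 2-dimensional normal local domain with a NON-REGULAR rational singularity,
`𝔪 = (t₁,…,t_s)`, `n ≥ 1`: `isBasis_principalCharts` (charts where `𝔪𝒪_X = (g)`, Prop. (3.1)); `prod_mem_pow`;
`subsingleton_cechMH1_kernel_mulMap` — **`Ȟ¹(𝒰, ker Ψₙ) = 0`** (the global Koszul sections `t^β(t_j ε_i − t_i ε_j)`,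
`|β| = n−1`, give `φ : 𝒪_X^N ↠ ker Ψₙ`, onto on principal charts by `…KoszulSyzygies.mem_span_monomial_koszul`; its kernel
is affine-localizing with `Ȟ² = 0` (`gwH2ResolutionDim2_holds`) and `Ȟ¹(𝒪_X^N) = 0` (rationality));
`sections_generate_pow_succ` (Γ-generation, `…PowerMulMapSections`); and, with `…ContractedSections`,
**`Lipman1969_8_1_holds : Lipman1969_8_1.{0}`**, **`Lipman1969_4_1_holds : Lipman1969_4_1.{0}`** — Prop. (8.1) and
Thm. (4.1) of Lipman 1969 in universe `0`, WITHOUT named facts.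

No crux, kill test or summit statement is proved here; resolution in positive characteristic is NOT proved.
References: J. Lipman, Publ. Math. IHÉS 36 (1969), Prop. (8.1) (p. 212), Thm. (7.2)/Lemma (7.3) (pp. 209–211),
Thm. (4.1) (p. 204) [`Lipman1969`]; R. Hartshorne, *Algebraic Geometry* (1977), III Thm. 4.5 (proof) [`Hartshorne1977`]. -/

noncomputable section

-- single-problem summit: the doubled namespace component `ResolutionOfSingularities` is forced
set_option linter.dupNamespace false
-- `TopCat.Presheaf`/`Scheme.Modules` are not reducible (as in Mathlib's `AlgebraicGeometry/Modules`).
set_option backward.isDefEq.respectTransparency false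

open CategoryTheory CategoryTheory.Limits AlgebraicGeometry TopologicalSpace Opposite IsLocalRing
open Literature.AlgebraicGeometry.Morphisms Literature.AlgebraicGeometry.Modules
open Literature.AlgebraicGeometry.Resolution
open Literature.AlgebraicGeometry.Motives (Scheme.Modules.Hom.app_map_apply)

namespace Summit.ResolutionOfSingularities.ResolutionOfSingularities.Theorems.NoZeno.QuadraticTransform

variable {S : Type} [CommRing S] {X : Scheme.{0}} (π : X ⟶ Spec (.of S))

/-! ## Principal charts of an effective Cartier ideal sheaf form a basis -/

/-- **The affine opens on which an effective Cartier ideal sheaf of an integral scheme is generated by one non-zero-divisor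
form a basis of the topology** (basic opens inside the Cartier charts). [cite: GortzWedhorn2020, (13.19) p. 413] -/
theorem isBasis_principalCharts [IsIntegral X] {I : X.IdealSheafData} (hI : IsEffectiveCartier I) :
    Opens.IsBasis {V : X.Opens | ∃ (hV : IsAffineOpen V) (g : Γ(X, V)),
      g ∈ nonZeroDivisors Γ(X, V) ∧ I.ideal ⟨V, hV⟩ = Ideal.span {g}} := by
  rw [Opens.isBasis_iff_nbhd]
  intro W x hxW
  obtain ⟨U, hxU, f, hf, hfU⟩ := hI x
  obtain ⟨h, hhW, hxh⟩ := U.2.exists_basicOpen_le ⟨x, hxW⟩ hxU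
  have hD : IsAffineOpen (X.basicOpen h) := U.2.basicOpen h
  refine ⟨X.basicOpen h, ⟨hD, X.presheaf.map (homOfLE (X.basicOpen_le h)).op f, ?_, ?_⟩, hxh, hhW⟩
  · -- `f|_{D(h)} ≠ 0` in the domain `Γ(D(h))`
    haveI : Nonempty (X.basicOpen h) := ⟨⟨x, hxh⟩⟩
    refine mem_nonZeroDivisors_of_ne_zero fun h0 => ?_
    have hgerm : (X.presheaf.germ U x hxU).hom f = 0 := by
      have e : (X.presheaf.germ U x hxU).hom f =
          (X.presheaf.germ (X.basicOpen h) x hxh).hom (X.presheaf.map (homOfLE (X.basicOpen_le h)).op f) := by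
        rw [← CommRingCat.comp_apply, TopCat.Presheaf.germ_res X.presheaf (homOfLE (X.basicOpen_le h)) x hxh]
      rw [e, h0, map_zero]
    have hf0 : f = 0 := germ_injective_of_isIntegral (X := X) x hxU (by rw [hgerm, map_zero])
    rw [hf0] at hf
    haveI : Nonempty (U : X.Opens) := ⟨⟨x, hxU⟩⟩
    exact zero_notMem_nonZeroDivisors hf
  · have e := I.map_ideal_basicOpen U h
    rw [hfU, Ideal.map_span, Set.image_singleton] at e
    exact e.symm

/-! ## Monomials in the generators -/

omit [CommRing S] in
/-- A product of `m` elements of an ideal lies in its `m`-th power. [folklore] -/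
theorem prod_mem_pow [CommRing S] {s : ℕ} {I : Ideal S} (t : Fin s → S) (ht : ∀ i, t i ∈ I) :
    ∀ (m : ℕ) (β : Fin m → Fin s), ∏ k, t (β k) ∈ I ^ m
  | 0, β => by rw [pow_zero, Ideal.one_eq_top]; exact Submodule.mem_top
  | m + 1, β => by
    rw [Fin.prod_univ_succ, pow_succ']
    exact Ideal.mul_mem_mul (ht _) (prod_mem_pow t ht m fun k => β k.succ)

/-! ## `Ȟ¹(ker Ψ) = 0` for the multiplication map with source twisted by an invertible `J` -/

set_option maxHeartbeats 400000 in
/-- **`Ȟ¹(𝒰, ker Ψ) = 0`** for the multiplication epimorphism `Ψ : ⨁ᵢ J𝒪_X ↠ (IJ)𝒪_X` (`I = (t₁,…,t_s) ⊆ S`) when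
`J = L^n` with `n ≥ 1`, `L = (t₁,…,t_s)` and `L𝒪_X` an EFFECTIVE CARTIER DIVISOR on the integral, separated `X` with
`Ȟ¹(𝒰, 𝒪_X) = 0` and `Ȟ² = 0` on affine-localizing modules: the global Koszul sections `t^β(t_j ε_i − t_i ε_j)`,
`|β| = n − 1`, generate `ker Ψ` (on a principal chart `L𝒪_X(V) = (g)`, `tᵢ = g vᵢ` with `(vᵢ)` unimodular and the
syzygies with values in `(gⁿ)` are spanned by these sections, `…KoszulSyzygies.mem_span_monomial_koszul`), so
`𝒪_X^N ↠ ker Ψ` with affine-localizing kernel, and `Ȟ¹` is right exact where `Ȟ² = 0`.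
[cite: Lipman1969, Lemma (7.3) (pp. 210–211); Hartshorne1977, III Thm. 4.5 (proof)] -/
theorem subsingleton_cechMH1_kernel_mulMap [IsIntegral X] [IsLocallyNoetherian X] [X.IsSeparated]
    [HasFiniteBiproducts X.Modules]
    {s : ℕ} (t : Fin s → S) {n : ℕ} (hn : 1 ≤ n)
    (hcart : IsEffectiveCartier (Scheme.IdealSheafData.ofIdealTop ((Ideal.span (Set.range t)).map (algebraMapΓ π))))
    (Ψ : (⨁ fun _ : Fin s => idealMul (unitModule X)
        (Scheme.IdealSheafData.ofIdealTop ((Ideal.span (Set.range t) ^ n).map (algebraMapΓ π)))) ⟶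
      idealMul (unitModule X)
        (Scheme.IdealSheafData.ofIdealTop ((Ideal.span (Set.range t) ^ (n + 1)).map (algebraMapΓ π))))
    (hΨ : ∀ i, biproduct.ι _ i ≫ Ψ ≫ idealMulι (unitModule X) _ =
      idealMulι (unitModule X) _ ≫ globalScalar (unitModule X) (algebraMapΓ π (t i)))
    {κ : Type} [Finite κ] (U : κ → X.Opens) (hUaff : ∀ k, IsAffineOpen (U k))
    (hO : Subsingleton (CechH1 π U))
    (hH2 : ∀ K : X.Modules, IsAffineLocalizing K → Subsingleton (CechMH2 π K U)) :
    Subsingleton (CechMH1 π (kernel Ψ) U) := by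
  classical
  -- notation-free abbreviations (as terms)
  let L : Ideal S := Ideal.span (Set.range t)
  let Jn : X.IdealSheafData := Scheme.IdealSheafData.ofIdealTop ((L ^ n).map (algebraMapΓ π))
  let Jn1 : X.IdealSheafData := Scheme.IdealSheafData.ofIdealTop ((L ^ (n + 1)).map (algebraMapΓ π))
  let F : Fin s → X.Modules := fun _ => idealMul (unitModule X) Jn
  have hti : ∀ i, t i ∈ L := fun i => Ideal.subset_span ⟨i, rfl⟩
  -- components of `Ψ` on sections
  have hcomp : ∀ (V : X.Opens) (i : Fin s) (m : Γ(idealMul (unitModule X) Jn, V)),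
      (idealMulι (unitModule X) Jn1).app V (Ψ.app V ((biproduct.ι F i).app V m)) =
        X.presheaf.map (homOfLE (le_top : V ≤ ⊤)).op (algebraMapΓ π (t i)) •
          (idealMulι (unitModule X) Jn).app V m := by
    intro V i m
    have h := congrArg (fun φ => φ.app V m) (hΨ i)
    simp only [Scheme.Modules.Hom.comp_app, CategoryTheory.comp_apply, globalScalar_app_apply] at h
    exact h
  -- sections of `Jn·𝒪_X` over `⊤` attached to elements of `L^n`
  have hsec : ∀ a : S, a ∈ L ^ n → ∃ m : Γ(idealMul (unitModule X) Jn, ⊤),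
      (idealMulι (unitModule X) Jn).app ⊤ m = (show Γ(unitModule X, ⊤) from algebraMapΓ π a) := fun a ha =>
    exists_idealMulι_app_eq (unitModule X) Jn _ (isIdealMulSection_top_of_mem (Ideal.mem_map_of_mem _ ha))
  choose sec hsec' using hsec
  -- the Koszul sections `κ_{β,i,j} = t^β t_j ε_i − t^β t_i ε_j`
  let Q : Type := (Fin (n - 1) → Fin s) × (Fin s × Fin s)
  have hmon : ∀ q : Q, ∀ l : Fin s, (∏ k, t (q.1 k)) * t l ∈ L ^ n := by
    intro q l
    have h1 := prod_mem_pow t hti (n - 1) q.1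
    have h2 : (∏ k, t (q.1 k)) * t l ∈ L ^ (n - 1 + 1) := by
      rw [pow_succ]
      exact Ideal.mul_mem_mul h1 (hti l)
    rwa [Nat.sub_add_cancel hn] at h2
  let κsec : Q → Γ((⨁ F), ⊤) := fun q =>
    (biproduct.ι F q.2.1).app ⊤ (sec _ (hmon q q.2.2)) - (biproduct.ι F q.2.2).app ⊤ (sec _ (hmon q q.2.1))
  have hκΨ : ∀ q, Ψ.app ⊤ (κsec q) = 0 := by
    intro q
    apply idealMulι_app_injective (unitModule X) Jn1 ⊤
    rw [map_zero, map_sub, map_sub, hcomp, hcomp, hsec', hsec']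
    have hres : ∀ a : Γ(X, ⊤), X.presheaf.map (homOfLE (le_top : (⊤ : X.Opens) ≤ ⊤)).op a = a := by
      intro a
      have : (homOfLE (le_top : (⊤ : X.Opens) ≤ ⊤)).op = 𝟙 (op ⊤) := Subsingleton.elim _ _
      rw [this, X.presheaf.map_id]; rfl
    rw [hres, hres]
    change algebraMapΓ π (t q.2.1) * algebraMapΓ π ((∏ k, t (q.1 k)) * t q.2.2) -
      algebraMapΓ π (t q.2.2) * algebraMapΓ π ((∏ k, t (q.1 k)) * t q.2.1) = 0
    rw [← map_mul, ← map_mul, ← map_sub]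
    have : t q.2.1 * ((∏ k, t (q.1 k)) * t q.2.2) - t q.2.2 * ((∏ k, t (q.1 k)) * t q.2.1) = 0 := by ring
    rw [this, map_zero]
  have hlift : ∀ q, ∃ m' : Γ(kernel Ψ, ⊤), (kernel.ι Ψ).app ⊤ m' = κsec q := fun q =>
    exists_kernel_ι_app_eq Ψ ⊤ _ (hκΨ q)
  choose κ' hκ' using hlift
  -- index by `Fin N`
  let e := Fintype.equivFin Q
  let N := Fintype.card Q
  let φ : freeMod X N ⟶ kernel Ψ := freeHomOfSections (kernel Ψ) fun l => κ' (e.symm l)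
  -- the basis sections of `𝒪^N` and their images
  let ef : Fin N → Γ(freeMod X N, ⊤) := fun l =>
    sectionsEquivTop (freeMod X N) (SheafOfModules.freeSection (ULift.up l))
  have hφe : ∀ (l : Fin N) (V : X.Opens),
      (kernel.ι Ψ).app V (φ.app V ((freeMod X N).presheaf.map (homOfLE (le_top : V ≤ ⊤)).op (ef l))) =
        (⨁ F).presheaf.map (homOfLE (le_top : V ≤ ⊤)).op (κsec (e.symm l)) := by
    intro l V
    rw [Scheme.Modules.Hom.app_map_apply, Scheme.Modules.Hom.app_map_apply, freeHomOfSections_app_top, hκ']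
  -- the component map `Θ_V : Γ(⨁ F, V) → (Fin s → Γ(X, V))`, linear and injective
  have hΘ : ∀ V : X.Opens, ∃ Θ : Γ((⨁ F), V) →ₗ[Γ(X, V)] (Fin s → Γ(X, V)),
      Function.Injective Θ ∧ ∀ z i, Θ z i =
        ((idealMulι (unitModule X) Jn).app V ((biproduct.π F i).app V z) : Γ(X, V)) := by
    intro V
    refine ⟨{ toFun := fun z i => ((idealMulι (unitModule X) Jn).app V ((biproduct.π F i).app V z) : Γ(X, V))
              map_add' := fun z z' => by funext i; simp only [map_add, Pi.add_apply]
              map_smul' := fun c z => by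
                funext i
                simp only [RingHom.id_apply, Pi.smul_apply]
                rw [Scheme.Modules.Hom.app_smul, Scheme.Modules.Hom.app_smul] }, ?_, fun z i => rfl⟩
    intro z z' hzz'
    have hc : ∀ i, (biproduct.π F i).app V z = (biproduct.π F i).app V z' := fun i =>
      idealMulι_app_injective (unitModule X) Jn V (congrFun hzz' i)
    rw [← app_sum_biproduct_ι_π F V z, ← app_sum_biproduct_ι_π F V z']
    exact Finset.sum_congr rfl fun i _ => by rw [hc i]
  -- components of `ιᵢ m` and of the Koszul sections
  have hπι : ∀ (V : X.Opens) (i l : Fin s) (m : Γ(idealMul (unitModule X) Jn, V)),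
      (biproduct.π F l).app V ((biproduct.ι F i).app V m) = if i = l then m else 0 := by
    intro V i l m
    by_cases h : i = l
    · subst h
      rw [if_pos rfl, ← CategoryTheory.comp_apply, ← Scheme.Modules.Hom.comp_app, biproduct.ι_π_self,
        Scheme.Modules.Hom.id_app]
      rfl
    · rw [if_neg h, ← CategoryTheory.comp_apply, ← Scheme.Modules.Hom.comp_app, biproduct.ι_π_ne F h,
        Scheme.Modules.Hom.zero_app]
      rfl
  -- `φ` is onto over every principal chart of `L𝒪_X`
  have hsurj : ∀ V ∈ {V : X.Opens | ∃ (hV : IsAffineOpen V) (g : Γ(X, V)), g ∈ nonZeroDivisors Γ(X, V) ∧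
      (Scheme.IdealSheafData.ofIdealTop (L.map (algebraMapΓ π))).ideal ⟨V, hV⟩ = Ideal.span {g}},
      Function.Surjective (φ.app V) := by
    rintro V ⟨hV, g, hg, hVg⟩ k
    obtain ⟨Θ, hΘinj, hΘ⟩ := hΘ V
    -- chart data: `Jn(V) = (gⁿ)`, `tᵢ|_V = g vᵢ`, `Σ wᵢ vᵢ = 1`
    obtain ⟨hJnV, v, w, htv, hw⟩ := chart_data_of_ideal_eq_span_singleton π t ⟨V, hV⟩ hg hVg n
    set tV : Fin s → Γ(X, V) := fun i => X.presheaf.map (homOfLE (le_top : V ≤ ⊤)).op (algebraMapΓ π (t i)) with htV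
    set z : Γ((⨁ F), V) := (kernel.ι Ψ).app V k with hz
    -- components `c i = gⁿ d i`
    have hcmem : ∀ i, Θ z i ∈ Ideal.span {g ^ n} := by
      intro i
      rw [hΘ, ← hJnV]
      have h := idealMulι_app_mem (M := unitModule X) (J := Jn) IsAffineLocalizing.unit hV ((biproduct.π F i).app V z)
      rwa [mem_ideal_smul_top_unitModule_iff] at h
    have hd : ∀ i, ∃ d : Γ(X, V), Θ z i = g ^ n * d := fun i => by
      obtain ⟨d, hd⟩ := Ideal.mem_span_singleton'.mp (hcmem i)
      exact ⟨d, by rw [← hd, mul_comm]⟩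
    choose d hdz using hd
    -- the relation `Σ tᵢ cᵢ = ι(Ψ z) = 0`
    have hrel : ∑ i, tV i * (g ^ n * d i) = 0 := by
      have h0 : Ψ.app V z = 0 := by rw [hz]; exact app_kernel_ι_app Ψ V k
      have h1 : (idealMulι (unitModule X) Jn1).app V (Ψ.app V z) =
          ∑ i, (idealMulι (unitModule X) Jn1).app V (Ψ.app V ((biproduct.ι F i).app V ((biproduct.π F i).app V z))) := by
        conv_lhs => rw [← app_sum_biproduct_ι_π F V z]
        rw [map_sum, map_sum]
      rw [h0, map_zero] at h1
      rw [h1]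
      refine Finset.sum_congr rfl fun i _ => ?_
      rw [hcomp, ← hdz i, hΘ]
      rfl
    have hspan := mem_span_monomial_koszul g hg v w tV hw htv n hn d hrel
    -- `Θ z` lies in the span of the `Θ (κ_q|_V)`
    -- components of the restricted Koszul sections
    have hresec : ∀ (a : S) (ha : a ∈ L ^ n),
        ((idealMulι (unitModule X) Jn).app V
          ((idealMul (unitModule X) Jn).presheaf.map (homOfLE (le_top : V ≤ ⊤)).op (sec a ha)) : Γ(X, V)) =
          X.presheaf.map (homOfLE (le_top : V ≤ ⊤)).op (algebraMapΓ π a) := by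
      intro a ha
      rw [Scheme.Modules.Hom.app_map_apply, hsec']
      rfl
    have hπres : ∀ (i l : Fin s) (m : Γ(idealMul (unitModule X) Jn, ⊤)),
        (biproduct.π F l).app V ((⨁ F).presheaf.map (homOfLE (le_top : V ≤ ⊤)).op ((biproduct.ι F i).app ⊤ m)) =
          if i = l then (idealMul (unitModule X) Jn).presheaf.map (homOfLE (le_top : V ≤ ⊤)).op m else 0 := by
      intro i l m
      rw [Scheme.Modules.Hom.app_map_apply, hπι]
      by_cases h : i = l
      · rw [if_pos h, if_pos h]
      · rw [if_neg h, if_neg h, map_zero]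
    have htmon : ∀ (q : Q) (l : Fin s),
        X.presheaf.map (homOfLE (le_top : V ≤ ⊤)).op (algebraMapΓ π ((∏ k, t (q.1 k)) * t l)) =
          (∏ k, tV (q.1 k)) * tV l := by
      intro q l
      simp only [map_mul, map_prod, htV]
    have hΘι : ∀ (q : Q) (i j : Fin s),
        Θ ((⨁ F).presheaf.map (homOfLE (le_top : V ≤ ⊤)).op ((biproduct.ι F i).app ⊤ (sec _ (hmon q j)))) =
          (∏ k, tV (q.1 k)) • (Pi.single i (tV j) : Fin s → Γ(X, V)) := by
      intro q i j
      funext l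
      rw [hΘ, hπres, Pi.smul_apply, smul_eq_mul]
      by_cases h : i = l
      · rw [if_pos h, hresec, htmon, ← h, Pi.single_eq_same]
      · rw [if_neg h, map_zero, Pi.single_eq_of_ne (Ne.symm h), mul_zero]
    have hΘκ : ∀ q : Q, Θ ((⨁ F).presheaf.map (homOfLE (le_top : V ≤ ⊤)).op (κsec q)) =
        (∏ k, tV (q.1 k)) • ((Pi.single q.2.1 (tV q.2.2) : Fin s → Γ(X, V)) - Pi.single q.2.2 (tV q.2.1)) := by
      intro q
      change Θ ((⨁ F).presheaf.map (homOfLE (le_top : V ≤ ⊤)).op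
        ((biproduct.ι F q.2.1).app ⊤ (sec _ (hmon q q.2.2)) - (biproduct.ι F q.2.2).app ⊤ (sec _ (hmon q q.2.1)))) = _
      rw [map_sub, map_sub, hΘι, hΘι, smul_sub]
    have hzspan : Θ z ∈ Submodule.span Γ(X, V)
        (Set.range fun l : Fin N => Θ ((⨁ F).presheaf.map (homOfLE (le_top : V ≤ ⊤)).op (κsec (e.symm l)))) := by
      have hfun : (fun i => g ^ n * d i) = Θ z := by funext i; rw [hdz]
      rw [← hfun]
      have hr : (Set.range fun l : Fin N => Θ ((⨁ F).presheaf.map (homOfLE (le_top : V ≤ ⊤)).op (κsec (e.symm l)))) =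
          Set.range fun q : Q => (∏ k, tV (q.1 k)) • ((Pi.single q.2.1 (tV q.2.2) : Fin s → Γ(X, V)) - Pi.single q.2.2 (tV q.2.1)) := by
        rw [show (fun l : Fin N => Θ ((⨁ F).presheaf.map (homOfLE (le_top : V ≤ ⊤)).op (κsec (e.symm l)))) =
          (fun q : Q => (∏ k, tV (q.1 k)) • ((Pi.single q.2.1 (tV q.2.2) : Fin s → Γ(X, V)) - Pi.single q.2.2 (tV q.2.1))) ∘ e.symm
          from funext fun l => hΘκ (e.symm l)]
        exact e.symm.surjective.range_comp _
      rw [hr]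
      exact hspan
    obtain ⟨a, ha⟩ := (Submodule.mem_span_range_iff_exists_fun _).mp hzspan
    -- the preimage
    refine ⟨∑ l, a l • (freeMod X N).presheaf.map (homOfLE (le_top : V ≤ ⊤)).op (ef l), ?_⟩
    apply kernel_ι_app_injective Ψ V
    apply hΘinj
    rw [map_sum, map_sum, map_sum, ← ha]
    refine Finset.sum_congr rfl fun l _ => ?_
    rw [Scheme.Modules.Hom.app_smul, Scheme.Modules.Hom.app_smul, map_smul, hφe]
  -- `φ` is an epimorphism (basis of principal charts)
  haveI : Epi φ := epi_of_surjective_on_basis φ (isBasis_principalCharts (X := X) hcart) hsurj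
  -- `0 → ker φ → 𝒪^N → ker Ψ → 0` and the right-exactness of `Ȟ¹`
  have hS : (ShortComplex.mk (kernel.ι φ) φ (kernel.condition _)).ShortExact :=
    ShortComplex.ShortExact.mk' (ShortComplex.exact_of_f_is_kernel _ (kernelIsKernel _)) inferInstance inferInstance
  have hJloc : IsAffineLocalizing (idealMul (unitModule X) Jn) :=
    isAffineLocalizing_idealMul (M := unitModule X) (J := Jn) IsAffineLocalizing.unit
  have hBloc : IsAffineLocalizing (⨁ F) := IsAffineLocalizing.biproduct F fun _ => hJloc
  have hkerΨ : IsAffineLocalizing (kernel Ψ) := IsAffineLocalizing.kernel Ψ hBloc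
    (isAffineLocalizing_idealMul (M := unitModule X) (J := Jn1) IsAffineLocalizing.unit)
  have hK : IsAffineLocalizing (kernel φ) := IsAffineLocalizing.kernel φ (coh_freeMod (X := X) N).loc hkerΨ
  have eF : (freeMod X N : X.Modules) ≅ SheafOfModules.free (R := X.ringCatSheaf) (ULift.{0} (Fin N)) := Iso.refl _
  exact subsingleton_cechMH1_of_shortExact_of_iso_free_of_isSeparated (I := ULift.{0} (Fin N)) π U hS eF hK hUaff hO
    (hH2 _ hK)

/-! ## Assembly: Γ-generation for `n ≥ 1`, and the discharge of `Lipman1969_8_1.{0}` / `Lipman1969_4_1.{0}` -/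

/-- `exists_epi_mulMap` with the target ideal named: `K = (t₁,…,t_s)·J`. [cite: Lipman1969, Lemma (7.3) (p. 210)] -/
theorem exists_epi_mulMap' [HasFiniteBiproducts X.Modules] {s : ℕ} (t : Fin s → S) (J K : Ideal S)
    (hK : Ideal.span (Set.range t) * J = K) :
    ∃ Ψ : (⨁ fun _ : Fin s => idealMul (unitModule X) (Scheme.IdealSheafData.ofIdealTop (J.map (algebraMapΓ π)))) ⟶
        idealMul (unitModule X) (Scheme.IdealSheafData.ofIdealTop (K.map (algebraMapΓ π))),
      (∀ i, biproduct.ι _ i ≫ Ψ ≫ idealMulι (unitModule X) _ =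
        idealMulι (unitModule X) _ ≫ globalScalar (unitModule X) (algebraMapΓ π (t i))) ∧ Epi Ψ := by
  subst hK
  exact exists_epi_mulMap π t J

/-- **Γ-generation `Γ(X, Mⁿ⁺¹𝒪_X) = Σ tᵢ·Γ(X, Mⁿ𝒪_X)` for `n ≥ 1`** on a desingularization `π : X → Spec S` of a
two-dimensional normal local domain with a NON-REGULAR rational singularity, `M = 𝔪 = (t₁,…,t_s)`: the multiplication map
`Ψₙ` is an epimorphism with `Ȟ¹(ker Ψₙ) = 0` (`subsingleton_cechMH1_kernel_mulMap`: Prop. (3.1) makes `𝔪𝒪_X` Cartier,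
rationality gives `Ȟ¹(𝒪_X) = 0`, Görtz–Wedhorn 24.44 gives `Ȟ² = 0`), so `Ψₙ` is onto on global sections.
[cite: Lipman1969, Theorem (7.2), Lemma (7.3) (pp. 209–211)] -/
theorem sections_generate_pow_succ [IsNoetherianRing S] [IsLocalRing S] [IsDomain S] [IsIntegrallyClosed S]
    (hdim : ringKrullDim S = 2) (hrat : HasRationalSingularity S) (hsing : ¬ IsRegularLocalRing S)
    (hπ : IsResolution π) {s : ℕ} (t : Fin s → S) (M : Ideal S) (hM : M = maximalIdeal S)
    (ht : Ideal.span (Set.range t) = M) (n : ℕ) (hn : 1 ≤ n)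
    (y : Γ(idealMul (unitModule X) (Scheme.IdealSheafData.ofIdealTop ((M ^ (n + 1)).map (algebraMapΓ π))), ⊤)) :
    ∃ m : Fin s → Γ(idealMul (unitModule X) (Scheme.IdealSheafData.ofIdealTop ((M ^ n).map (algebraMapΓ π))), ⊤),
      (show Γ(X, ⊤) from (idealMulι (unitModule X) _).app ⊤ y) =
        ∑ i, algebraMapΓ π (t i) * (show Γ(X, ⊤) from (idealMulι (unitModule X) _).app ⊤ (m i)) := by
  classical
  subst ht
  haveI : IsProper π := hπ.isProper
  haveI : IsIntegral X := hπ.isIntegral_source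
  haveI : IsLocallyNoetherian X := LocallyOfFiniteType.isLocallyNoetherian π
  haveI : X.IsSeparated := ⟨by rw [← terminal.comp_from π]; infer_instance⟩
  haveI : CompactSpace X := QuasiCompact.compactSpace_of_compactSpace π
  haveI : HasFiniteBiproducts X.Modules := HasFiniteBiproducts.of_hasFiniteProducts
  -- a finite affine open cover with `Ȟ¹(𝒪_X) = 0` and `Ȟ² = 0`
  obtain ⟨𝒮, h𝒮, hcov⟩ := (isCompact_iff_finite_and_eq_biUnion_affineOpens (U := (⊤ : X.Opens))).mp
    (CompactSpace.isCompact_univ (X := X))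
  haveI : Finite 𝒮 := h𝒮.to_subtype
  let U : 𝒮 → X.Opens := fun i => (i.1 : X.Opens)
  have hUaff : ∀ i, IsAffineOpen (U i) := fun i => i.1.2
  have hUcov : ⨆ i, U i = ⊤ := by
    change ⨆ i : 𝒮, ((i.1 : X.affineOpens) : X.Opens) = ⊤
    rw [iSup_subtype'', ← hcov]
  have hO : Subsingleton (CechH1 π U) :=
    NoZeno.Lipman12B.hasTrivialCechH1_of_isResolution_of_hasRationalSingularity hdim hrat π hπ _ U hUaff hUcov
  have hH2 : ∀ K : X.Modules, IsAffineLocalizing K → Subsingleton (CechMH2 π K U) := fun K hK =>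
    gwH2ResolutionDim2_holds S hdim X π hπ K hK _ U hUaff hUcov
  -- `𝔪𝒪_X` is an effective Cartier divisor (Prop. (3.1))
  have hcart : IsEffectiveCartier
      (Scheme.IdealSheafData.ofIdealTop ((Ideal.span (Set.range t)).map (algebraMapΓ π))) := by
    have h := isEffectiveCartier_baseIdeal_maximalIdeal π hdim hrat hsing hπ
    rwa [← hM] at h
  -- the multiplication map `Ψₙ` and `Ȟ¹(ker Ψₙ) = 0`
  obtain ⟨Ψ, hΨ, hepi⟩ := exists_epi_mulMap' π t (Ideal.span (Set.range t) ^ n) (Ideal.span (Set.range t) ^ (n + 1))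
    (pow_succ' _ n).symm
  haveI := hepi
  have hH1 : Subsingleton (CechMH1 π (kernel Ψ) U) :=
    subsingleton_cechMH1_kernel_mulMap π t hn hcart Ψ hΨ U hUaff hO hH2
  exact sections_generate_of_subsingleton_cechMH1_kernel π t _ _ Ψ hΨ U hUaff hUcov hH1 y

/-- **Lipman 1969, Proposition (8.1), universe `0` — THEOREM (no named fact)**: the quadratic transform `Bl_𝔪(Spec S)` of
a two-dimensional normal Noetherian local domain with a rational singularity is normal.  Regular `S`: the blow-up is
regular (`…Lipman81Of72`).  Non-regular `S`: on a desingularization the powers `𝔪ⁿ` are contracted (Γ-generation,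
`sections_generate_pow_succ`; base case `𝔪` contracted), hence complete (`\overline{𝔪ⁿ} ⊆ Γ(X, 𝔪ⁿ𝒪_X) ∩ S` by
Prop. (3.1)), hence every local ring of `Bl_𝔪(Spec S)` is integrally closed (Lemma (5.2)).
[cite: Lipman1969, Proposition (8.1) (p. 212)] -/
theorem Lipman1969_8_1_holds : Lipman1969_8_1.{0} := by
  intro S _ _ _ _ _ hdim hrat y
  by_cases hreg : IsRegularLocalRing S
  · exact isIntegrallyClosed_stalk_affineBlowup_of_isRegularLocalRing y
  · have hrat' := hrat
    obtain ⟨X, π, hπ, -⟩ := hrat'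
    obtain ⟨s, t, ht⟩ := Submodule.fg_iff_exists_fin_generating_family.mp
      ((isNoetherianRing_iff_ideal_fg S).mp inferInstance (maximalIdeal S))
    have htm : ∀ i, t i ∈ maximalIdeal S := fun i => ht ▸ Ideal.subset_span ⟨i, rfl⟩
    exact isIntegrallyClosed_stalk_affineBlowup_of_sections_generate π hdim hrat hreg hπ t htm
      (fun n hn y => sections_generate_pow_succ π hdim hrat hreg hπ t (maximalIdeal S) rfl ht n hn y) y

/-- **Lipman 1969, Theorem (4.1), universe `0` — THEOREM (no named fact)**: a normal surface (integral Noetherian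
separated scheme of dimension two with integrally closed local rings) with finitely many singular points, all rational
singularities, has a minimal desingularization — by Lipman's own proof (hand 21's assembly through Prop. (3.1), the global
blow-up step and termination; hand 16 g4's globalisation) and Proposition (8.1) (`Lipman1969_8_1_holds`).
[cite: Lipman1969, Theorem (4.1) (p. 204)] -/
theorem Lipman1969_4_1_holds : Lipman1969_4_1.{0} :=
  Lipman1969_4_1_of_8_1 Lipman1969_8_1_holds

/-- The local form consumed by the crux chain: a two-dimensional normal Noetherian local domain with a rational
singularity has a MINIMAL desingularization of `Spec S`, which is a blowing up along a centre cosupported at the closed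
point — now UNCONDITIONAL. [cite: Lipman1969, Theorem (4.1) (p. 204); Proposition (8.1) (p. 212)] -/
theorem exists_isMinimalResolution_isBlowup {S : Type} [CommRing S] [IsNoetherianRing S] [IsLocalRing S] [IsDomain S]
    [IsIntegrallyClosed S] (hdim : ringKrullDim S = 2) (hrat : HasRationalSingularity S) :
    ∃ (X₀ : Scheme.{0}) (f : X₀ ⟶ Spec (.of S)) (J : (Spec (.of S)).IdealSheafData),
      IsMinimalResolution f ∧ IsBlowup f J ∧ (J.support : Set (Spec (.of S))) ⊆ {closedPoint S} :=
  exists_isMinimalResolution_isBlowup_of_8_1 Lipman1969_8_1_holds hdim hrat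

end Summit.ResolutionOfSingularities.ResolutionOfSingularities.Theorems.NoZeno.QuadraticTransform

end
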